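import Summits.RiemannHypothesis.RiemannHypothesis.Theorems.SignConeSignConeDuality
import Summits.RiemannHypothesis.RiemannHypothesis.Theorems.SignConeSignConeOscillatoryIffInequality
import Summits.RiemannHypothesis.RiemannHypothesis.Theorems.SignConeSignConeOscillatoryRouteCorollaries

/-!
# The crux `SignConeOscillatory` IS the feasibility of the unit-slack cones at every cutoff
(route `SignCone`, item stmt-RiemannHypothesis-16302; HELPER file, `--supports` — it closes nothing)

Capstone of the structural results on the crux, now that `SignConeDuality` is a theorem
(`SignConeDuality.signConeDuality_proof`, item stmt-RiemannHypothesis-16304) and the oscillation hypothesis has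
been shown to carry no information under the `∀`-cutoff quantifier
(`signConeOscillatory_iff_signConeInequality`, gap-bump appending):

* `signConeInequalityAt_iff_exists_fakeWeight` — CUTOFF BY CUTOFF, the unit-slack sign-cone inequality at `a` holds
  iff the unit-slack cone `K♭_a` is non-empty (some non-negative weight `c`, `c 1 = 0`, has
  `Re (W_ar - P_c)(g ⋆ g̃) ≥ -‖g‖₂²` on the Weil tests supported in `[-a, a]`): `→` is the proved crux
  `SignConeDuality` at `a`, `←` is `neg_re_apply_zero_le_re_weilArchPolar_of_fakeWeight_unitSlack`;
* `signConeInequality_iff_coneMagnificationHyp`, `signConeOscillatory_iff_coneMagnificationHyp` — hence the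
  target AND the crux are each equivalent, unconditionally, to the antecedent of `ConeMagnification` verbatim;
* `riemannHypothesis_of_signConeOscillatory_of_coneMagnification` — the route's deciding theorem needs only TWO of
  its four hypotheses (`closes h₁ h₂ h₃ h₄` with `h₃ := signConeDuality_proof`, `h₄` a corollary of `h₁`);
* `coneMagnification_iff_signConeOscillatory_imp`, `signConeOscillatory_iff_riemannHypothesis_of_coneMagnification` —
  so the route has collapsed to exactly two statements about the one proposition
  `H := ∀ a > 0, K♭_a ≠ ∅`: the crux says `H` (RH-strength: `RH → H` in-tree, `H → RH` is `ConeMagnification`),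
  and `ConeMagnification` says `H → RH`; given the latter, the crux is literally equivalent to the summit.
-/

noncomputable section

-- the summit-side namespace `Summit.RiemannHypothesis.RiemannHypothesis.…` (D-0017: Sub = Summit) repeats a component
set_option linter.dupNamespace false

open scoped BigOperators
open MeasureTheory Set

namespace Summit.RiemannHypothesis.RiemannHypothesis.Theorems.SignCone

open Literature.NumberTheory.LFunctions
open Summit.RiemannHypothesis.RiemannHypothesis.Theses.SignCone
open Summit.RiemannHypothesis.RiemannHypothesis.Theorems.SignConeDuality (signConeDuality_proof)

/-! ## Cutoff by cutoff: the inequality at `a` iff `K♭_a ≠ ∅` -/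

/-- **The unit-slack sign-cone inequality at ONE cutoff `a > 0` holds iff the unit-slack cone `K♭_a` is
non-empty** (both sides verbatim over Mathlib primitives, as in the route decls `SignConeDuality` /
`ConeMagnification`): `→` is the crux `SignConeDuality` at `a` (proved, `signConeDuality_proof`), `←` is the
bookkeeping `neg_re_apply_zero_le_re_weilArchPolar_of_fakeWeight_unitSlack` (`P_c(F) ≥ 0` on node-nonnegative `F`
for every `c ≥ 0`). [folklore] -/
theorem signConeInequalityAt_iff_exists_fakeWeight {a : ℝ} (ha : 0 < a) :
    (∀ (k : ℕ) (g : Fin k → ℝ → ℂ), (∀ i, (ContDiff ℝ ((⊤ : ℕ∞) : WithTop ℕ∞) (g i) ∧ HasCompactSupport (g i)) ∧ tsupport (g i) ⊆ Set.Icc (-a) a) → let F : ℝ → ℂ := fun t => ∑ i, MeasureTheory.convolution (g i) (fun u => (starRingEnd ℂ) ((g i) (-u))) (ContinuousLinearMap.mul ℂ ℂ) MeasureTheory.MeasureSpace.volume t; (∀ n : ℕ, 2 ≤ n → 0 ≤ (F (Real.log n)).re) → let M : ℂ → ℂ := fun s => ∫ u : ℝ, F u * Complex.exp ((s - 1 /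 2) * u); -(F 0).re ≤ (M 0 + M 1 + ((1 / (2 * Real.pi) : ℂ) * (∫ t : ℝ, M (1 / 2 + t * Complex.I) * ((Complex.digamma (1 / 4 + t / 2 * Complex.I)).re : ℂ)) - F 0 * (Real.log Real.pi : ℂ))).re) ↔
    ∃ c : ℕ → ℝ, (∀ n, 0 ≤ c n) ∧ c 1 = 0 ∧ ∀ g : ℝ → ℂ, (ContDiff ℝ ((⊤ : ℕ∞) : WithTop ℕ∞) g ∧ HasCompactSupport g) → tsupport g ⊆ Set.Icc (-a) a → let G : ℝ → ℂ := MeasureTheory.convolution g (fun u => (starRingEnd ℂ) (g (-u))) (ContinuousLinearMap.mul ℂ ℂ) MeasureTheory.MeasureSpace.volume; let M : ℂ → ℂ := fun s => ∫ u : ℝ, G u * Complex.exp ((s - 1 / 2) * u); -(∫ t, ‖g t‖ ^ 2) ≤ (M 0 + M 1 + ((1 / (2 * Real.pi) : ℂ) * (∫ t : ℝ, M (1 / 2 + t * Complex.I) * ((Complex.digamma (1 / 4 + t / 2 * Complex.I)).re : ℂ)) - G 0 * (Real.log Real.pi : ℂ)) - ∑' n : ℕ, ((c n : ℝ) : ℂ)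 / (Real.sqrt n : ℂ) * (G (Real.log n) + G (-Real.log n))).re := by
  refine ⟨fun hX => signConeDuality_proof a ha hX, fun ⟨c, hc, _, hcW⟩ => ?_⟩
  intro k g hg F hn M
  show -(F 0).re ≤ (weilPolarTerm F + weilArchTerm F).re
  exact neg_re_apply_zero_le_re_weilArchPolar_of_fakeWeight_unitSlack (b := a) hc
    (fun g' hg' hs' => hcW g' hg' hs') (g := g) (F := F) rfl (fun i => (hg i).1) (fun i => (hg i).2) hn

/-! ## All cutoffs: the target and the crux are the antecedent of `ConeMagnification` -/

/-- `SignConeInequality` gives a unit-slack fake weight at every cutoff (the antecedent of `ConeMagnification`,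
verbatim) — the proved crux `SignConeDuality`, cutoff by cutoff. [folklore] -/
theorem coneMagnificationHyp_of_signConeInequality (h : SignConeInequality) :
    ∀ a : ℝ, 0 < a → ∃ c : ℕ → ℝ, (∀ n, 0 ≤ c n) ∧ c 1 = 0 ∧ ∀ g : ℝ → ℂ, (ContDiff ℝ ((⊤ : ℕ∞) : WithTop ℕ∞) g ∧ HasCompactSupport g) → tsupport g ⊆ Set.Icc (-a) a → let G : ℝ → ℂ := MeasureTheory.convolution g (fun u => (starRingEnd ℂ) (g (-u))) (ContinuousLinearMap.mul ℂ ℂ) MeasureTheory.MeasureSpace.volume; let M : ℂ → ℂ := fun s => ∫ u : ℝ, G u * Complex.exp ((s - 1 / 2) * u); -(∫ t, ‖g t‖ ^ 2) ≤ (M 0 + M 1 + ((1 / (2 * Real.pi) : ℂ) * (∫ t : ℝ, M (1 / 2 + t * Complex.I) * ((Complex.digamma (1 / 4 + t / 2 * Complex.I)).re : ℂ)) - G 0 * (Real.log Real.pi : ℂ)) - ∑' n : ℕ, ((c n : ℝ) : ℂ) / (Real.sqrt n : ℂ) * (G (Real.log n) + G (-Real.log n))).re :=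
  fun a ha => signConeDuality_proof a ha (h a ha)

/-- **The target is the feasibility of every unit-slack cone**: `SignConeInequality ↔ ∀ a > 0, K♭_a ≠ ∅`
(the right-hand side is the antecedent of the route decl `ConeMagnification`, verbatim). [folklore] -/
theorem signConeInequality_iff_coneMagnificationHyp :
    SignConeInequality ↔
    ∀ a : ℝ, 0 < a → ∃ c : ℕ → ℝ, (∀ n, 0 ≤ c n) ∧ c 1 = 0 ∧ ∀ g : ℝ → ℂ, (ContDiff ℝ ((⊤ : ℕ∞) : WithTop ℕ∞) g ∧ HasCompactSupport g) → tsupport g ⊆ Set.Icc (-a) a → let G : ℝ → ℂ := MeasureTheory.convolution g (fun u => (starRingEnd ℂ) (g (-u))) (ContinuousLinearMap.mul ℂ ℂ) MeasureTheory.MeasureSpace.volume; let M : ℂ → ℂ := fun s => ∫ u : ℝ, G u * Complex.exp ((s - 1 / 2) * u); -(∫ t, ‖g t‖ ^ 2) ≤ (M 0 + M 1 + ((1 / (2 * Real.pi) : ℂ) * (∫ t : ℝ, M (1 / 2 + t * Complex.I) * ((Complex.digamma (1 / 4 + t / 2 * Complex.I)).re : ℂ)) - G 0 * (Real.log Real.pi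 : ℂ)) - ∑' n : ℕ, ((c n : ℝ) : ℂ) / (Real.sqrt n : ℂ) * (G (Real.log n) + G (-Real.log n))).re :=
  ⟨coneMagnificationHyp_of_signConeInequality, signConeInequality_of_coneMagnificationHyp⟩

/-- **The crux is the feasibility of every unit-slack cone**: `SignConeOscillatory ↔ ∀ a > 0, K♭_a ≠ ∅`
(through `signConeOscillatory_iff_signConeInequality`). In particular the crux is literally the antecedent of its
sibling `ConeMagnification`. [folklore] -/
theorem signConeOscillatory_iff_coneMagnificationHyp :
    SignConeOscillatory ↔
    ∀ a : ℝ, 0 < a → ∃ c : ℕ → ℝ, (∀ n, 0 ≤ c n) ∧ c 1 = 0 ∧ ∀ g : ℝ → ℂ, (ContDiff ℝ ((⊤ : ℕ∞) : WithTop ℕ∞) g ∧ HasCompactSupport g) → tsupport g ⊆ Set.Icc (-a) a → let G : ℝ → ℂ := MeasureTheory.convolution g (fun u => (starRingEnd ℂ) (g (-u))) (ContinuousLinearMap.mul ℂ ℂ) MeasureTheory.MeasureSpace.volume; let M : ℂ → ℂ := fun s => ∫ u : ℝ, G u * Complex.exp ((s - 1 / 2) * u); -(∫ t, ‖g t‖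 ^ 2) ≤ (M 0 + M 1 + ((1 / (2 * Real.pi) : ℂ) * (∫ t : ℝ, M (1 / 2 + t * Complex.I) * ((Complex.digamma (1 / 4 + t / 2 * Complex.I)).re : ℂ)) - G 0 * (Real.log Real.pi : ℂ)) - ∑' n : ℕ, ((c n : ℝ) : ℂ) / (Real.sqrt n : ℂ) * (G (Real.log n) + G (-Real.log n))).re :=
  signConeOscillatory_iff_signConeInequality.trans signConeInequality_iff_coneMagnificationHyp

/-! ## The route from two hypotheses -/

/-- **The deciding theorem from two hypotheses**: `SignConeOscillatory → ConeMagnification → RiemannHypothesis`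
(`SignConeDuality` is proved and `SignConeFarField` follows from the crux, so `closes` needs only `h₁, h₂`). [folklore] -/
theorem riemannHypothesis_of_signConeOscillatory_of_coneMagnification (h₁ : SignConeOscillatory)
    (h₂ : ConeMagnification) : Summit.RiemannHypothesis :=
  h₂ (signConeOscillatory_iff_coneMagnificationHyp.1 h₁)

/-- Given `ConeMagnification` alone, the crux is EQUIVALENT to the summit (`←` is the in-tree envelope
`signConeOscillatory_of_riemannHypothesis`: explicit formula + the easy half of Weil's criterion). [folklore] -/
theorem signConeOscillatory_iff_riemannHypothesis_of_coneMagnification (h₂ : ConeMagnification) :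
    SignConeOscillatory ↔ Summit.RiemannHypothesis :=
  ⟨fun h₁ => riemannHypothesis_of_signConeOscillatory_of_coneMagnification h₁ h₂,
    signConeOscillatory_of_riemannHypothesis⟩

/-- **`ConeMagnification` is exactly "the crux implies the summit"**: `ConeMagnification ↔
(SignConeOscillatory → RiemannHypothesis)`. So the route consists of the single proposition
`H := ∀ a > 0, K♭_a ≠ ∅` asserted twice over: the crux says `H`, the magnification crux says `H → RH`. [folklore] -/
theorem coneMagnification_iff_signConeOscillatory_imp :
    ConeMagnification ↔ (SignConeOscillatory → Summit.RiemannHypothesis) :=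
  ⟨fun h₂ h₁ => riemannHypothesis_of_signConeOscillatory_of_coneMagnification h₁ h₂,
    fun h hc => h (signConeOscillatory_iff_coneMagnificationHyp.2 hc)⟩

end Summit.RiemannHypothesis.RiemannHypothesis.Theorems.SignCone

end
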